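import Mathlib

/-!
# T5AutExtension — every embedding of a countable field into `ℂ` extends to an automorphism
# of `ℂ` (blind cell pub-hodge-repro2; support for route/T4-B4-p1.md, B4's cited input)

T4-B4 (sub-claim B4, orientation / sign convention) cites «extension of embeddings to `Aut(ℂ)`»
(Hungerford, *Algebra*, Thm V.3.8) as a printed input: for two embeddings `σ₁, σ₂ : K → ℂ` of a
number field there is `τ ∈ Aut(ℂ)` with `τ ∘ σ₁ = σ₂`, so every `σ` is `τ ∘ ι` for the base
embedding `ι` (B4 §B4.0; `InducedTypeSplitting` / `IsogenyTransport` use it in prose).  This file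
proves it from Mathlib's classification of algebraically closed fields by transcendence bases:

* `exists_ringEquiv_comp_eq` — `K` a COUNTABLE field, `σ₁ σ₂ : K →+* ℂ`: `∃ τ : ℂ ≃+* ℂ`,
  `τ (σ₁ x) = σ₂ x` for all `x`.  Proof: with the `K`-algebra structures `σ₁`, `σ₂` on `ℂ` pick
  transcendence bases `s`, `t` (`exists_isTranscendenceBasis`); both have the cardinality of `ℂ`
  (`IsAlgClosed.cardinal_eq_cardinal_transcendence_basis_of_aleph0_lt'`, `#K ≤ ℵ₀ < 𝔠 = #ℂ`), so
  `s ≃ t`; the induced `K`-algebra isomorphism `K[s] ≃ₐ[K] K[t]` of the adjoined subalgebras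
  (`AlgebraicIndependent.aevalEquiv`, `MvPolynomial.rename`) extends to the algebraic closures
  (`IsAlgClosure.equivOfEquiv`), and `IsAlgClosure.equivOfEquiv_algebraMap` + `AlgEquiv.commutes`
  give `τ ∘ σ₁ = σ₂`.
* `NumberField.countable` — a number field is countable (`Module.finBasis ℚ K`).
* `exists_ringEquiv_comp_eq_of_numberField` — the statement for number fields.

Mathlib only; no sorry; axioms ⊆ {propext, Classical.choice, Quot.sound}.
-/

namespace Summit.Ventures.HodgeRepro2.T5AutExtension

open Cardinal

/-- A copy of `ℂ`, to carry a second `K`-algebra structure without instance clashes. -/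
def ComplexCopy : Type := ℂ

/-- `ComplexCopy` is a field (the field `ℂ`). -/
noncomputable instance : Field ComplexCopy := inferInstanceAs (Field ℂ)

/-- `ComplexCopy` is algebraically closed (as `ℂ` is). -/
instance : IsAlgClosed ComplexCopy := inferInstanceAs (IsAlgClosed ℂ)

/-- `#ComplexCopy = 𝔠`. -/
theorem mk_complexCopy : #ComplexCopy = Cardinal.continuum := Cardinal.mk_complex

/-- A number field is countable. -/
theorem NumberField.countable (K : Type*) [Field K] [NumberField K] : Countable K :=
  Countable.of_equiv _ (Module.finBasis ℚ K).equivFun.toEquiv.symm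

/-- **Extension of embeddings to `Aut(ℂ)`.** For a countable field `K` and embeddings
`σ₁ σ₂ : K →+* ℂ` there is `τ ∈ Aut(ℂ)` with `τ ∘ σ₁ = σ₂`. -/
theorem exists_ringEquiv_comp_eq {K : Type*} [Field K] [Countable K] (σ₁ σ₂ : K →+* ℂ) :
    ∃ τ : ℂ ≃+* ℂ, ∀ x, τ (σ₁ x) = σ₂ x := by
  -- `ℂ` with the `K`-structure `σ₁`; `C₂ = ComplexCopy` with the `K`-structure `σ₂`
  letI A₁ : Algebra K ℂ := σ₁.toAlgebra
  haveI : FaithfulSMul K ℂ := (faithfulSMul_iff_algebraMap_injective K ℂ).2 σ₁.injective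
  let σ₂' : K →+* ComplexCopy := σ₂
  letI A₂ : Algebra K ComplexCopy := σ₂'.toAlgebra
  haveI : FaithfulSMul K ComplexCopy :=
    (faithfulSMul_iff_algebraMap_injective K ComplexCopy).2 σ₂.injective
  obtain ⟨s, hs⟩ := exists_isTranscendenceBasis K ℂ
  obtain ⟨t, ht⟩ := exists_isTranscendenceBasis K ComplexCopy
  have hC : ℵ₀ < #ℂ := by rw [Cardinal.mk_complex]; exact Cardinal.aleph0_lt_continuum
  have hC₂ : ℵ₀ < #ComplexCopy := by rw [mk_complexCopy]; exact Cardinal.aleph0_lt_continuum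
  have hcard₁ : #ℂ = #s := by
    simpa using IsAlgClosed.cardinal_eq_cardinal_transcendence_basis_of_aleph0_lt _ hs
      Cardinal.mk_le_aleph0 hC
  have hcard₂ : #ComplexCopy = #t := by
    simpa using IsAlgClosed.cardinal_eq_cardinal_transcendence_basis_of_aleph0_lt _ ht
      Cardinal.mk_le_aleph0 hC₂
  have hst : #s = #t := by rw [← hcard₁, ← hcard₂, Cardinal.mk_complex, mk_complexCopy]
  obtain ⟨e⟩ : Nonempty (s ≃ t) := Cardinal.eq.1 hst
  -- the `K`-algebra isomorphism of the adjoined subalgebras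
  let e' : Algebra.adjoin K (Set.range ((↑) : s → ℂ)) ≃ₐ[K]
      Algebra.adjoin K (Set.range ((↑) : t → ComplexCopy)) :=
    hs.1.aevalEquiv.symm.trans
      ((AlgEquiv.ofAlgHom (MvPolynomial.rename e) (MvPolynomial.rename e.symm)
        (by ext; simp) (by ext; simp)).trans ht.1.aevalEquiv)
  haveI := IsAlgClosed.isAlgClosure_of_transcendence_basis _ hs
  haveI := IsAlgClosed.isAlgClosure_of_transcendence_basis _ ht
  let τ : ℂ ≃+* ComplexCopy := IsAlgClosure.equivOfEquiv ℂ ComplexCopy e'.toRingEquiv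
  refine ⟨τ, fun x => ?_⟩
  have h1 : σ₁ x = algebraMap (Algebra.adjoin K (Set.range ((↑) : s → ℂ))) ℂ
      (algebraMap K (Algebra.adjoin K (Set.range ((↑) : s → ℂ))) x) := by
    rw [← IsScalarTower.algebraMap_apply, RingHom.algebraMap_toAlgebra]
  have h2 : σ₂' x = algebraMap (Algebra.adjoin K (Set.range ((↑) : t → ComplexCopy))) ComplexCopy
      (algebraMap K (Algebra.adjoin K (Set.range ((↑) : t → ComplexCopy))) x) := by
    rw [← IsScalarTower.algebraMap_apply, RingHom.algebraMap_toAlgebra]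
  change τ (σ₁ x) = σ₂' x
  rw [h1, h2, IsAlgClosure.equivOfEquiv_algebraMap, AlgEquiv.coe_ringEquiv, e'.commutes]

/-- The extension statement for number fields. -/
theorem exists_ringEquiv_comp_eq_of_numberField {K : Type*} [Field K] [NumberField K]
    (σ₁ σ₂ : K →+* ℂ) : ∃ τ : ℂ ≃+* ℂ, ∀ x, τ (σ₁ x) = σ₂ x :=
  haveI := NumberField.countable K
  exists_ringEquiv_comp_eq σ₁ σ₂


/-! ## Appendix (v2, appended): the domain version, and the Galois theory of `ℂ/L` for a countable
subfield `L` — `Fix(Aut(ℂ/L)) = L` -/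

/-- **Extension of embeddings, domain version.** For a countable domain `K` and injective ring
homomorphisms `σ₁ σ₂ : K →+* ℂ` there is `τ ∈ Aut(ℂ)` with `τ ∘ σ₁ = σ₂` (same proof; the
transcendence-basis machinery works over any domain). -/
theorem exists_ringEquiv_comp_eq_of_injective {K : Type*} [CommRing K] [IsDomain K] [Countable K]
    (σ₁ σ₂ : K →+* ℂ) (h₁ : Function.Injective σ₁) (h₂ : Function.Injective σ₂) :
    ∃ τ : ℂ ≃+* ℂ, ∀ x, τ (σ₁ x) = σ₂ x := by
  letI A₁ : Algebra K ℂ := σ₁.toAlgebra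
  haveI : FaithfulSMul K ℂ := (faithfulSMul_iff_algebraMap_injective K ℂ).2 h₁
  let σ₂' : K →+* ComplexCopy := σ₂
  letI A₂ : Algebra K ComplexCopy := σ₂'.toAlgebra
  haveI : FaithfulSMul K ComplexCopy :=
    (faithfulSMul_iff_algebraMap_injective K ComplexCopy).2 h₂
  obtain ⟨s, hs⟩ := exists_isTranscendenceBasis K ℂ
  obtain ⟨t, ht⟩ := exists_isTranscendenceBasis K ComplexCopy
  have hC : ℵ₀ < #ℂ := by rw [Cardinal.mk_complex]; exact Cardinal.aleph0_lt_continuum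
  have hC₂ : ℵ₀ < #ComplexCopy := by rw [mk_complexCopy]; exact Cardinal.aleph0_lt_continuum
  have hcard₁ : #ℂ = #s := by
    simpa using IsAlgClosed.cardinal_eq_cardinal_transcendence_basis_of_aleph0_lt _ hs
      Cardinal.mk_le_aleph0 hC
  have hcard₂ : #ComplexCopy = #t := by
    simpa using IsAlgClosed.cardinal_eq_cardinal_transcendence_basis_of_aleph0_lt _ ht
      Cardinal.mk_le_aleph0 hC₂
  have hst : #s = #t := by rw [← hcard₁, ← hcard₂, Cardinal.mk_complex, mk_complexCopy]
  obtain ⟨e⟩ : Nonempty (s ≃ t) := Cardinal.eq.1 hst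
  let e' : Algebra.adjoin K (Set.range ((↑) : s → ℂ)) ≃ₐ[K]
      Algebra.adjoin K (Set.range ((↑) : t → ComplexCopy)) :=
    hs.1.aevalEquiv.symm.trans
      ((AlgEquiv.ofAlgHom (MvPolynomial.rename e) (MvPolynomial.rename e.symm)
        (by ext; simp) (by ext; simp)).trans ht.1.aevalEquiv)
  haveI := IsAlgClosed.isAlgClosure_of_transcendence_basis _ hs
  haveI := IsAlgClosed.isAlgClosure_of_transcendence_basis _ ht
  let τ : ℂ ≃+* ComplexCopy := IsAlgClosure.equivOfEquiv ℂ ComplexCopy e'.toRingEquiv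
  refine ⟨τ, fun x => ?_⟩
  have h1 : σ₁ x = algebraMap (Algebra.adjoin K (Set.range ((↑) : s → ℂ))) ℂ
      (algebraMap K (Algebra.adjoin K (Set.range ((↑) : s → ℂ))) x) := by
    rw [← IsScalarTower.algebraMap_apply, RingHom.algebraMap_toAlgebra]
  have h2 : σ₂' x = algebraMap (Algebra.adjoin K (Set.range ((↑) : t → ComplexCopy))) ComplexCopy
      (algebraMap K (Algebra.adjoin K (Set.range ((↑) : t → ComplexCopy))) x) := by
    rw [← IsScalarTower.algebraMap_apply, RingHom.algebraMap_toAlgebra]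
  change τ (σ₁ x) = σ₂' x
  rw [h1, h2, IsAlgClosure.equivOfEquiv_algebraMap, AlgEquiv.coe_ringEquiv, e'.commutes]

/-- A finite-dimensional vector space over a countable field is countable. -/
theorem countable_of_finiteDimensional (K V : Type*) [Field K] [Countable K] [AddCommGroup V]
    [Module K V] [FiniteDimensional K V] : Countable V :=
  Countable.of_equiv _ (Module.finBasis K V).equivFun.toEquiv.symm

section Galois

open IntermediateField

variable (L : Subfield ℂ) [Countable L]

/-- `z ∉ L` algebraic over `L`: an automorphism of `ℂ` fixing `L` pointwise moves `z`
(to another root of its minimal polynomial, through `PowerBasis.lift` on `L⟮z⟯`). -/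
theorem exists_fix_ne_of_isAlgebraic {z : ℂ} (hz : z ∉ L) (halg : IsAlgebraic L z) :
    ∃ τ : ℂ ≃+* ℂ, (∀ x ∈ L, τ x = x) ∧ τ z ≠ z := by
  have hint : IsIntegral L z := halg.isIntegral
  have hdeg : 2 ≤ (minpoly L z).natDegree := by
    have h1 : (minpoly L z).natDegree ≠ 1 := by
      intro h
      have hd : (minpoly L z).degree = 1 := by
        rw [Polynomial.degree_eq_natDegree (minpoly.ne_zero hint), h]; rfl
      rw [minpoly.degree_eq_one_iff] at hd
      obtain ⟨y, hy⟩ := hd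
      exact hz (hy ▸ y.2)
    have h0 := minpoly.natDegree_pos hint
    omega
  have hsep : (minpoly L z).Separable := (minpoly.irreducible hint).separable
  have hsplit : (Polynomial.map (algebraMap L ℂ) (minpoly L z)).Splits := IsAlgClosed.splits _
  have hcard : Fintype.card ((minpoly L z).rootSet ℂ) = (minpoly L z).natDegree :=
    Polynomial.card_rootSet_eq_natDegree hsep hsplit
  have hz_mem : z ∈ (minpoly L z).rootSet ℂ := by
    rw [Polynomial.mem_rootSet]; exact ⟨minpoly.ne_zero hint, minpoly.aeval L z⟩
  have hlt : 1 < Fintype.card ((minpoly L z).rootSet ℂ) := by rw [hcard]; omega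
  obtain ⟨⟨z', hz'⟩, hne⟩ :=
    Fintype.exists_ne_of_one_lt_card hlt (⟨z, hz_mem⟩ : (minpoly L z).rootSet ℂ)
  have hz'root : Polynomial.aeval z' (minpoly L z) = 0 := (Polynomial.mem_rootSet.1 hz').2
  have hne' : z' ≠ z := fun h => hne (Subtype.ext h)
  let pb := adjoin.powerBasis hint
  have hpb : Polynomial.aeval z' (minpoly L pb.gen) = 0 := by
    rw [adjoin.powerBasis_gen, minpoly_gen]; exact hz'root
  let σ₂ : L⟮z⟯ →ₐ[L] ℂ := pb.lift z' hpb
  let σ₁ : L⟮z⟯ →ₐ[L] ℂ := IntermediateField.val _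
  haveI : FiniteDimensional L L⟮z⟯ := adjoin.finiteDimensional hint
  haveI : Countable L⟮z⟯ := countable_of_finiteDimensional L L⟮z⟯
  obtain ⟨τ, hτ⟩ := exists_ringEquiv_comp_eq σ₁.toRingHom σ₂.toRingHom
  refine ⟨τ, fun x hx => ?_, ?_⟩
  · have h := hτ (algebraMap L L⟮z⟯ ⟨x, hx⟩)
    have e1 : σ₁.toRingHom (algebraMap L L⟮z⟯ ⟨x, hx⟩) = x := σ₁.commutes ⟨x, hx⟩
    have e2 : σ₂.toRingHom (algebraMap L L⟮z⟯ ⟨x, hx⟩) = x := σ₂.commutes ⟨x, hx⟩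
    rw [e1, e2] at h
    exact h
  · have h := hτ (AdjoinSimple.gen L z)
    have h1 : σ₁.toRingHom (AdjoinSimple.gen L z) = z := rfl
    have h2 : σ₂.toRingHom (AdjoinSimple.gen L z) = z' := by
      show pb.lift z' hpb (AdjoinSimple.gen L z) = z'
      rw [← adjoin.powerBasis_gen hint]
      exact pb.lift_gen z' hpb
    rw [h1, h2] at h
    rw [h]; exact hne'

/-- `z` transcendental over `L`: an automorphism of `ℂ` fixing `L` pointwise moves `z`
(to `z + 1`, through `L[z] ≅ L[X]`, `X ↦ z + 1`, and the domain version of the extension). -/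
theorem exists_fix_ne_of_transcendental {z : ℂ} (htr : Transcendental L z) :
    ∃ τ : ℂ ≃+* ℂ, (∀ x ∈ L, τ x = x) ∧ τ z ≠ z := by
  have htr' : Transcendental L (z + 1) := by
    intro halg
    apply htr
    have h := halg.add (isAlgebraic_algebraMap (-1 : L))
    simpa using h
  have hinj : Function.Injective (Polynomial.aeval z : Polynomial L →ₐ[L] ℂ) :=
    transcendental_iff_injective.1 htr
  have hinj' : Function.Injective (Polynomial.aeval (z + 1) : Polynomial L →ₐ[L] ℂ) :=
    transcendental_iff_injective.1 htr'
  -- `R = L[z] = (aeval z).range ≅ L[X]`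
  let e₁ : Polynomial L ≃ₐ[L] (Polynomial.aeval z : Polynomial L →ₐ[L] ℂ).range :=
    AlgEquiv.ofInjective _ hinj
  haveI : Countable (AddMonoidAlgebra L ℕ) :=
    Function.Injective.countable (f := AddMonoidAlgebra.coeff) fun a b h => by
      cases a; cases b; congr
  haveI : Countable (Polynomial L) := Polynomial.toFinsupp_injective.countable
  haveI : Countable (Polynomial.aeval z : Polynomial L →ₐ[L] ℂ).range :=
    Countable.of_equiv _ e₁.toEquiv
  let σ₁ : (Polynomial.aeval z : Polynomial L →ₐ[L] ℂ).range →+* ℂ := (Subalgebra.val _).toRingHom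
  let σ₂ : (Polynomial.aeval z : Polynomial L →ₐ[L] ℂ).range →+* ℂ :=
    ((Polynomial.aeval (z + 1) : Polynomial L →ₐ[L] ℂ).comp e₁.symm.toAlgHom).toRingHom
  have h₂ : Function.Injective σ₂ := hinj'.comp e₁.symm.injective
  obtain ⟨τ, hτ⟩ := exists_ringEquiv_comp_eq_of_injective σ₁ σ₂ Subtype.val_injective h₂
  have hz_mem : z ∈ (Polynomial.aeval z : Polynomial L →ₐ[L] ℂ).range :=
    (AlgHom.mem_range _).2 ⟨Polynomial.X, Polynomial.aeval_X z⟩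
  have hX : e₁ Polynomial.X = ⟨z, hz_mem⟩ := by
    apply Subtype.ext
    rw [AlgEquiv.ofInjective_apply, Polynomial.aeval_X]
  refine ⟨τ, fun x hx => ?_, ?_⟩
  · have h := hτ (algebraMap L _ ⟨x, hx⟩)
    have e2 := ((Polynomial.aeval (z + 1) : Polynomial L →ₐ[L] ℂ).comp e₁.symm.toAlgHom).commutes
      ⟨x, hx⟩
    exact h.trans e2
  · have h := hτ ⟨z, hz_mem⟩
    have h1 : σ₁ ⟨z, hz_mem⟩ = z := rfl
    have h2 : σ₂ ⟨z, hz_mem⟩ = z + 1 := by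
      show (Polynomial.aeval (z + 1) : Polynomial L →ₐ[L] ℂ) (e₁.symm ⟨z, hz_mem⟩) = z + 1
      rw [← hX, AlgEquiv.symm_apply_apply, Polynomial.aeval_X]
    rw [h1, h2] at h
    rw [h]
    exact fun h' => one_ne_zero (add_left_cancel (h'.trans (add_zero z).symm))

/-- **Galois theory of `ℂ/L`, `L` countable.** For `z ∉ L` there is `τ ∈ Aut(ℂ)` fixing `L`
pointwise with `τ z ≠ z`. -/
theorem exists_fix_ne {z : ℂ} (hz : z ∉ L) :
    ∃ τ : ℂ ≃+* ℂ, (∀ x ∈ L, τ x = x) ∧ τ z ≠ z := by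
  by_cases halg : IsAlgebraic L z
  · exact exists_fix_ne_of_isAlgebraic L hz halg
  · exact exists_fix_ne_of_transcendental L halg

/-- `Fix(Aut(ℂ/L)) = L`: `z ∈ L` iff every automorphism of `ℂ` fixing `L` pointwise fixes `z`. -/
theorem mem_iff_forall_fix (z : ℂ) :
    z ∈ L ↔ ∀ τ : ℂ ≃+* ℂ, (∀ x ∈ L, τ x = x) → τ z = z := by
  refine ⟨fun hz τ hτ => hτ z hz, fun h => ?_⟩
  by_contra hz
  obtain ⟨τ, hτ, hne⟩ := exists_fix_ne L hz
  exact hne (h τ hτ)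

/-- The same, as subfields: the intersection of the equalisers `{z : τ z = z}` over all
`τ ∈ Aut(ℂ)` fixing `L` pointwise is `L` (the shape of a reflex-field definition). -/
theorem iInf_eqLocusField_eq :
    (⨅ τ ∈ {τ : ℂ ≃+* ℂ | ∀ x ∈ L, τ x = x}, (τ : ℂ →+* ℂ).eqLocusField (RingHom.id ℂ)) = L := by
  ext z
  simp only [Subfield.mem_iInf, RingHom.mem_eqLocusField, RingHom.id_apply, Set.mem_setOf_eq,
    RingEquiv.coe_toRingHom]
  exact (mem_iff_forall_fix L z).symm

end Galois

end Summit.Ventures.HodgeRepro2.T5AutExtension
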